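import Summits.CriticalPhenomena.CardyFormulaZ2.Theorems.CardySusyWardParafermionFamiliesToSLESixIkhlefPonsaing
import Summits.CriticalPhenomena.CardyFormulaZ2.Theorems.CardySusyWardParafermionFamiliesToSLESixTotalSmallLayer
import Summits.CriticalPhenomena.CardyFormulaZ2.Theorems.ParafermionPrecompact.Negative.TwoPassages
import Literature.Probability.LatticeModels.MedialInterfaceMeasurability

/-!
# An unconditional by-product of the line `strip-anchored-vertex-normalisation` (crux stmt-CriticalPhenomena-10814):
# the critical bond-percolation exploration path of the anchor square visits `≥ c δ^{-5/3}` medial vertices in mean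

Lead c4. By `totalVertexSum_lower` (`…IkhlefPonsaing.lean`, p138858: the moment identity + the anchor first moment +
Ikhlef–Ponsaing's strip law, now a theorem) the total spin-`1/3` vertex observable of the concrete anchor family satisfies
`c δ^{-5/3} ≤ ‖Σ_{p ∈ S_max} F_δ(p)‖` eventually in `δ`. Since the exploration path passes at most twice through a medial
vertex (`norm_passageSum_medialExploration_le_two`) and `passageSum` vanishes off the path, `‖F_δ(p)‖ ≤ 2·P(z_p ∈ γ)`
(`norm_vertexObs_le_two_mul_real_mem`); summing over the random both-faces-inner medial vertices gives

* `visitMass_lower`: `Σ_{p ∈ S_max} P(z_p ∈ γ_δ) ≥ (c/2) δ^{-5/3}` eventually, and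
* `expectedVisitedNcard_lower`: `E[#{p ∈ S_max : z_p ∈ γ_δ}] ≥ (c/2) δ^{-5/3}` — the expected number of (random,
  both-faces-inner) medial vertices visited by the exploration path of the anchor square at mesh `δ` is at least
  `(c/2) δ^{-5/3}`.

This is an UNCONDITIONAL lower bound with the sharp-looking exponent `5/3` (the true growth is `δ^{-7/4}`, the path having
dimension `7/4`; the a priori lower bound from the Aizenman–Burchard regularity theory is `δ^{-(1+s)}` with an inexplicit
`s > 0`) for the length of the critical percolation interface on `ℤ²`, obtained from a PHASED identity: the wall touch mass
`≍ δ^{-2/3}` (sharp boundary exponent `1/3`, Ikhlef–Ponsaing) weighted by `|ẑ| ≍ δ^{-1}` is transported into the bulk by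
the half-Cauchy–Riemann Green identity and bounded there by the number of visits.

References: Y. Ikhlef, A. K. Ponsaing, J. Stat. Phys. 149 (2012) 10–36; M. Aizenman, A. Burchard, Duke Math. J. 99 (1999)
419–453; H. Duminil-Copin, S. Smirnov, *Conformal invariance of lattice models* (2012), §8.
-/

noncomputable section

namespace Summit.CriticalPhenomena.CardyFormulaZ2.Theorems.ParafermionFamiliesToSLESix.StripAnchored

open MeasureTheory Filter Set Metric
open scoped Topology BigOperators
open Literature.Probability.LatticeModels (DiscreteDobrushin MedialVertex Site medialPoint medialExploration zdGraph
  measurable_of_medialExploration)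
open Literature.Probability.Percolation (bondPercolation half BondConfig)
open Literature.Probability.RandomPlanarGeometry (DobrushinDomain)
open Literature.Barriers.CriticalPhenomena (medialVertexOf)
open Summit.CriticalPhenomena.CardyFormulaZ2.Theorems.ParafermionPrecompact.Negative (IsFamily
  norm_passageSum_medialExploration_le_two)
open S5 (anchorDomain)

variable {E : DiscreteDobrushin}

/-- **The visit event of a medial vertex is measurable** (it is read off the medial exploration, a measurable map into a
countable type: `measurable_of_medialExploration`). [folklore] -/
theorem measurableSet_mem_medialExploration (E : DiscreteDobrushin) (z : MedialVertex) :
    MeasurableSet {ω : BondConfig (Site 2) | z ∈ medialExploration E ω} := by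
  have h : Measurable (fun ω : BondConfig (Site 2) => decide (z ∈ medialExploration E ω)) :=
    measurable_of_medialExploration E fun ω ω' hω => by simp only [hω]
  have hset : {ω : BondConfig (Site 2) | z ∈ medialExploration E ω} =
      (fun ω : BondConfig (Site 2) => decide (z ∈ medialExploration E ω)) ⁻¹' {true} := by
    ext ω
    simp
  rw [hset]
  exact h (measurableSet_singleton _)

/-- **`‖F_δ(z)‖ ≤ 2 · P(z ∈ γ)`**: for admissible data the exploration passes at most twice through a medial vertex
(`norm_passageSum_medialExploration_le_two`) and the passage sum vanishes off the path, so the integrand of the vertex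
observable is bounded by `2 · 𝟙{z ∈ γ}`. [folklore] -/
theorem norm_vertexObs_le_two_mul_real_mem (hE : E.IsZdAdmissible) (δ : ℝ) (z : MedialVertex) :
    ‖vertexObs E δ z‖ ≤ 2 * (bondPercolation (zdGraph 2) half).real {ω | z ∈ medialExploration E ω} := by
  set S : Set (BondConfig (Site 2)) := {ω | z ∈ medialExploration E ω} with hSdef
  have hS : MeasurableSet S := measurableSet_mem_medialExploration E z
  have hpt : ∀ ω, ‖Literature.Probability.LatticeModels.MedialPath.passageSum (medialExploration E ω) δ (1 / 3) z‖ ≤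
      S.indicator (fun _ => (2 : ℝ)) ω := by
    intro ω
    by_cases hω : ω ∈ S
    · rw [Set.indicator_of_mem hω]
      exact norm_passageSum_medialExploration_le_two hE ω δ _ z
    · rw [Set.indicator_of_notMem hω,
        Literature.Probability.LatticeModels.MedialPath.passageSum_eq_zero_of_not_mem δ _ hω, norm_zero]
  calc ‖vertexObs E δ z‖
      ≤ ∫ ω, S.indicator (fun _ => (2 : ℝ)) ω ∂(bondPercolation (zdGraph 2) half) := by
        unfold vertexObs
        exact norm_integral_le_of_norm_le ((integrable_const (2 : ℝ)).indicator hS) (Eventually.of_forall hpt)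
    _ = 2 * (bondPercolation (zdGraph 2) half).real S := by
        rw [integral_indicator hS, setIntegral_const, smul_eq_mul, mul_comm]

open Classical in
/-- **Visit mass ≥ (c/2) δ^{-5/3}, unconditionally**: along the concrete anchor family, eventually in `δ`, the sum over the
random both-faces-inner medial vertices `p` of the visit probabilities `P(z_p ∈ γ_δ)` is at least `(c/2) δ^{-5/3}`
(`totalVertexSum_lower` and `‖F_δ(p)‖ ≤ 2 P(z_p ∈ γ)`). [folklore] -/
theorem visitMass_lower : ∃ Λ : ℝ → DiscreteDobrushin, IsFamily anchorDomain Λ ∧ ∃ c : ℝ, 0 < c ∧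
    ∀ᶠ δ in 𝓝[>] (0:ℝ), c * δ ^ (-(5:ℝ) / 3) ≤
      ∑ᶠ p : Site 2 × Fin 2, (if IsRandomMV (Λ δ) p then
        (bondPercolation (zdGraph 2) half).real {ω | medialVertexOf p ∈ medialExploration (Λ δ) ω} else 0) := by
  classical
  obtain ⟨Λ, hΛ, c, hc, hbig⟩ := totalVertexSum_lower
  refine ⟨Λ, hΛ, c / 2, by positivity, ?_⟩
  filter_upwards [hbig, hΛ.2.2.2.2.2] with δ hge hadm
  set μ := bondPercolation (zdGraph 2) half
  set RS := (TotalSmall.finite_random hadm).toFinset with hRSdef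
  have hRS : ∀ p, p ∈ RS ↔ IsRandomMV (Λ δ) p := fun p => Set.Finite.mem_toFinset _
  -- `finsum` → finite sums over the random vertices
  have htot : ‖totalVertexSum (Λ δ) δ‖ ≤ ∑ p ∈ RS, ‖vertexObs (Λ δ) δ (medialVertexOf p)‖ := by
    unfold totalVertexSum
    rw [finsum_eq_sum_of_support_subset (s := RS)]
    · refine (norm_sum_le _ _).trans (Finset.sum_le_sum fun p hp => ?_)
      rw [if_pos ((hRS p).1 hp)]
    · intro p hp
      rw [Function.mem_support] at hp
      by_cases hcp : IsRandomMV (Λ δ) p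
      · exact Finset.mem_coe.2 ((hRS p).2 hcp)
      · exact absurd (if_neg hcp) hp
  have hfin : ∑ᶠ p : Site 2 × Fin 2, (if IsRandomMV (Λ δ) p then
      μ.real {ω | medialVertexOf p ∈ medialExploration (Λ δ) ω} else 0) =
      ∑ p ∈ RS, μ.real {ω | medialVertexOf p ∈ medialExploration (Λ δ) ω} := by
    rw [finsum_eq_sum_of_support_subset (s := RS)]
    · exact Finset.sum_congr rfl fun p hp => if_pos ((hRS p).1 hp)
    · intro p hp
      rw [Function.mem_support] at hp
      by_cases hcp : IsRandomMV (Λ δ) p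
      · exact Finset.mem_coe.2 ((hRS p).2 hcp)
      · exact absurd (if_neg hcp) hp
  have hsum : ∑ p ∈ RS, ‖vertexObs (Λ δ) δ (medialVertexOf p)‖ ≤
      2 * ∑ p ∈ RS, μ.real {ω | medialVertexOf p ∈ medialExploration (Λ δ) ω} := by
    rw [Finset.mul_sum]
    exact Finset.sum_le_sum fun p _ => norm_vertexObs_le_two_mul_real_mem hadm δ _
  rw [hfin]
  have h3 : c * δ ^ (-(5:ℝ) / 3) ≤ 2 * ∑ p ∈ RS, μ.real {ω | medialVertexOf p ∈ medialExploration (Λ δ) ω} :=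
    hge.trans (htot.trans hsum)
  linarith

/-- **The exploration path of the anchor square visits at least `(c/2) δ^{-5/3}` random medial vertices in mean,
unconditionally**: the expected number of random both-faces-inner medial vertices `p` with `z_p ∈ γ_δ` is at least
`(c/2) δ^{-5/3}` eventually in `δ` (the visit mass of `visitMass_lower` is this expectation, by exchanging the finite sum
with the integral). In particular the mean number of medial vertices on the critical bond-percolation exploration path of the
anchor square at mesh `δ` grows at least like `δ^{-5/3}`. [folklore] -/
theorem expectedVisitedNcard_lower : ∃ Λ : ℝ → DiscreteDobrushin, IsFamily anchorDomain Λ ∧ ∃ c : ℝ, 0 < c ∧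
    ∀ᶠ δ in 𝓝[>] (0:ℝ), c * δ ^ (-(5:ℝ) / 3) ≤
      ∫ ω, (({p : Site 2 × Fin 2 | IsRandomMV (Λ δ) p ∧ medialVertexOf p ∈ medialExploration (Λ δ) ω}.ncard : ℕ) : ℝ)
        ∂(bondPercolation (zdGraph 2) half) := by
  classical
  obtain ⟨Λ, hΛ, c, hc, hvis⟩ := visitMass_lower
  refine ⟨Λ, hΛ, c, hc, ?_⟩
  filter_upwards [hvis, hΛ.2.2.2.2.2] with δ hge hadm
  set μ := bondPercolation (zdGraph 2) half
  set RS := (TotalSmall.finite_random hadm).toFinset with hRSdef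
  have hRS : ∀ p, p ∈ RS ↔ IsRandomMV (Λ δ) p := fun p => Set.Finite.mem_toFinset _
  -- the visit events
  set V : Site 2 × Fin 2 → Set (BondConfig (Site 2)) := fun p => {ω | medialVertexOf p ∈ medialExploration (Λ δ) ω}
    with hVdef
  have hV : ∀ p, MeasurableSet (V p) := fun p => measurableSet_mem_medialExploration (Λ δ) (medialVertexOf p)
  -- the finsum of probabilities is the finite sum
  have hfin : ∑ᶠ p : Site 2 × Fin 2, (if IsRandomMV (Λ δ) p then μ.real (V p) else 0) = ∑ p ∈ RS, μ.real (V p) := by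
    rw [finsum_eq_sum_of_support_subset (s := RS)]
    · exact Finset.sum_congr rfl fun p hp => if_pos ((hRS p).1 hp)
    · intro p hp
      rw [Function.mem_support] at hp
      by_cases hcp : IsRandomMV (Λ δ) p
      · exact Finset.mem_coe.2 ((hRS p).2 hcp)
      · exact absurd (if_neg hcp) hp
  -- pointwise: the `ncard` is the finite sum of the indicators
  have hpt : ∀ ω, (({p : Site 2 × Fin 2 | IsRandomMV (Λ δ) p ∧ medialVertexOf p ∈ medialExploration (Λ δ) ω}.ncard : ℕ) : ℝ)
      = ∑ p ∈ RS, (V p).indicator (fun _ => (1 : ℝ)) ω := by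
    intro ω
    have hset : {p : Site 2 × Fin 2 | IsRandomMV (Λ δ) p ∧ medialVertexOf p ∈ medialExploration (Λ δ) ω} =
        ↑(RS.filter fun p => ω ∈ V p) := by
      ext p
      simp only [Set.mem_setOf_eq, Finset.coe_filter, hRS, hVdef]
    rw [hset, Set.ncard_coe_finset]
    have hind : ∀ p ∈ RS, (V p).indicator (fun _ => (1 : ℝ)) ω = if ω ∈ V p then 1 else 0 := fun p _ =>
      Set.indicator_apply (V p) (fun _ => (1 : ℝ)) ω
    rw [Finset.sum_congr rfl hind, Finset.sum_boole]
  have hint : ∫ ω, (({p : Site 2 × Fin 2 | IsRandomMV (Λ δ) p ∧ medialVertexOf p ∈ medialExploration (Λ δ) ω}.ncard : ℕ) : ℝ) ∂μ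
      = ∑ p ∈ RS, μ.real (V p) := by
    simp_rw [hpt]
    rw [integral_finsetSum RS fun p _ => (integrable_const (1 : ℝ)).indicator (hV p)]
    refine Finset.sum_congr rfl fun p _ => ?_
    rw [integral_indicator (hV p), setIntegral_const, smul_eq_mul, mul_one]
  rw [hint, ← hfin]
  exact hge

end Summit.CriticalPhenomena.CardyFormulaZ2.Theorems.ParafermionFamiliesToSLESix.StripAnchored

end
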